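import Summits.HodgeConjecture.HodgeConjecture.Theses.FirstOrderSemiregularSeeds
import Summits.HodgeConjecture.HodgeConjecture.Theorems.FirstOrderSemiregularSeedsFirstOrderWeilSeedsEightCLfDesignPad4
import Literature.AlgebraicGeometry.Modules.SerreSubbundleOfTwists
import Literature.AlgebraicGeometry.HodgeTheory.WeilClassesFourfoldsProofs
import Literature.AlgebraicGeometry.Motives.AbelianVarietyProductDimProofs
import Literature.NumberTheory.EllipticCurves.CMEndomorphismOfMulMemLattice
import Literature.AlgebraicGeometry.HodgeTheory.HyperbolicWeilTypeExistence
import HarnessLib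
import HarnessLib.Audit

/-!
# Line `birthS` (BC3 / BC5 PLAN-ONLY skeleton, v4) — crux `FirstOrderSemiregularSeeds.FirstOrderWeilSeedsEightCS` (X2‴)
# (item stmt-HodgeConjecture-24864, route route-HodgeConjecture-FirstOrderSemiregularSeeds rev 7/8, bc144cab7ef9 / 35f560ad6b15)
# tribunal-w planner `hodge-fos-w-1` g3, 2026-08-28.  Predecessors: `Lines/birthC.lean` v1/v2 (ASIDE X2′ = `FirstOrderWeilSeedsEightC`),
# `Lines/birthP.lean` v3 (ASIDE X2″ = `FirstOrderWeilSeedsEightCP`, the ∀-C Fulton antecedent).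

HONEST FRAMING. Nothing in this file proves X2‴, X2″, X2′, X1, rung H2 (`SevenfoldWeilCensus.WeilSixfolds`), HC for abelian
varieties or the Hodge conjecture. TWO statements are SORRIED STUBS (`stub_firstOrderLift_pad4` ⟹ `stub_firstOrderLift_pad4_at`,
the rung; only `_at` is load-bearing); everything else is proved here or in the tree. No instrument result so far supports the
rung (kit j292340: every tested design fails first-order liftability on ≥ 10 of the 16 Weil rows).

Crux (VERBATIM the route decl, concluded BY NAME below): `FirstOrderWeilSeedsEightCS` —
`Literature.AlgebraicGeometry.Modules.Hartshorne1977_serre_subbundleOfTwists →` for EVERY Chern-character theory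
`C : ChernCharacterBetti` and every `d > 0`, `HasHyperbolicSeedOn 𝒪_C 4 d` (some complex abelian EIGHTFOLD `P` with
`ψ₀ ≫ ψ₀ = -d`, HYPERBOLIC for a `K`-symmetrised hyperplane class `h_K = d·e^*a + ψ₀^*e^*a`, a non-zero rational class `w` of
its `ℚ(√-d)`-Weil space, and an `𝒪_C`-SEED for `q·h_K⁴ + w`: a finite locally free `E₀` on `P.X` with `ch_p(E₀) = κ_p`
(`κ₄ = q·h⁴ + w`, `κ_p = c_p·hᵖ` otherwise, `p ≤ 8`) that LIFTS TO FIRST ORDER along every smooth projective family through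
`P.X` on which all `ch_p(E₀)` stay of Hodge type).  `𝒪_C` is the route's inlined object class, NAMED here `foClass C` (same
lambda; `firstOrderWeilSeedsEightCS_iff` is `Iff.rfl`).  The antecedent is the refereed, CHERN-CHARACTER-FREE NAMED FACT displayed
in the route binder `SerreTwistSubbundles` (K-S): Serre's theorem A in sub-bundle form — every finite locally free `E` on a complex
scheme with a projective embedding `e` sits in `0 → E → (e^*L₀)^{⊕(k+1)} → Q → 0` with `L₀` locally free of rank `≤ 1` on `ℙⁿ`
(print: `𝒪(m)`, `m ≫ 0`) and `Q` finite locally free [Hartshorne II Thm. 5.17 p. 153 + II Cor. 5.18 + II Ex. 5.1, dualised] —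
landed p596006 (hodge-fos-kappa-p1), render-checked by this seat against the materialised page (locator and derivation verified).

## What changed against v3 (`birthP.lean`) and v2 (`birthC.lean`)
* The displayed K-input is WEAKER and C-free: Serre instead of the `∀ C` Fulton presentation fact (which is DERIVABLE from the
  `ChernCharacterBetti` axioms + Serre: SPAN with rational coefficients ⇒ Vandermonde purification along the isogenies `[1],…,[9]`
  (`ch_p([m]^*E) = m^{2p}·ch_p(E)`) ⇒ integer multiplicities / direct sums `E±` ⇒ Serre complement of `E₋` inside `(e_K^*L₀)^{⊕(k+1)}`
  after the `K`-symmetrised re-embedding — memo hodge-fos-w-1 g2, EXECUTED and LANDED by hodge-fos-kappa-p1: p595967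
  `ChernCharacterBettiSums`, p596006 the fact, p597041 `Theorems/FirstOrderSemiregularSeedsFirstOrderWeilSeedsEightCLfDesignPad4`).
* THE CLASS HALF IS IN THE TREE modulo Serre: `Theorems.lfDesign_pad4_of_serre` / `Theorems.kappaDesign_pad4_of_serre` (p597041) are
  the v2 stub texts `stub_lfDesign_pad4` / `stub_kappaDesign_pad4` with `Ψ := pad4Action E₀ ψ₀` (`rfl`) and `𝒪 := lfDesignClass C`;
  `kappaDesign_pad4_of_serre'` below is the one-line citation.  No class-half stub remains.
* Registered stubs: R (uniform rung) and R_at (pinned rung, LOAD-BEARING) — texts byte-for-byte those of v2/v3.  Composition: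
  `FirstOrderWeilSeedsEightCS_of := fun hS ↦ R_at ∘ (class half from hS)` — the crux BY NAME; sorries only inside `stub_*`.

## Why-clause (tribunal T3 / BC5 — PLAN-ONLY; flag `T3-plan-only` expected, unchanged designate)
RUNG DESIGNATE = `stub_firstOrderLift_pad4_at` — «if the anchor `S_d⁴(E₀)` carries SOME hyperbolic datum `(e, a, w)` with an f.l.f.
κ-design (a THEOREM modulo the displayed Serre fact, for every `C` and `d`), it carries SOME such datum with a FIRST-ORDER-LIFTABLE
f.l.f. κ-design».  ONE certified 16/16 design with its own typed `(e, a, w)` proves it outright.  WHY IT IS A WITNESS OF THE LEVER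
AND NOT OF S: (i) it lives on EIGHTFOLDS (n = 4), where the amplification chain's output (`WeilAlgebraicSplitHyperplane 4 d` ⇒ every
`√-d` sixfold) is open — in print Weil classes are algebraic on fourfolds (Markman 2025, all d) and on special CM/product members
only; (ii) its content is DEFORMATION-THEORETIC — `θ(ξ)·At(E₀) = 0 ∈ Ext²(E₀,E₀)` for the 16 Weil rows `ξ ∈ T_W` at the anchor —
which HC AT THE ANCHOR (on `E₀⁸`, `E₀` CM, every `(p,p)` class is a polynomial in divisors; exactly what the class half USES) does NOT
give: algebraicity of `w` at one CM point says nothing about a bundle carrying `N·w` that survives to first order towards the generic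
hyperbolic point, where HC is open; (iii) it exercises exactly the route's lever (admissibility = first-order liftability instead of
σ-injectivity).  NAMED TECHNIQUE: the Atiyah-class row test `θ(ξ) = ξ ∪ At(E₀)` on the 16 rows (instrument seat `hodge-fos-x2-inst-1`,
kit j292340 dictionary; §Reductions R1–R3 of `birthC.lean`: the design must contain an indecomposable summand with NON-SCALAR Atiyah
class that is not a box product — in particular NOT the direct-sum-plus-Serre-complement bundle of the class half, whose first-order
behaviour is unknown), then `LiftsAlong` over square-zero Artinian points.  Instrument status (j292340): genus-4 Jacobian End-secant
designs 9/1/6 (Schottky row fails), `E⁴` coordinate designs ≤ 6/16; untested: complete-intersection designs (a₃,d) = (1,5), (0,12),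
theta designs (arXiv:2502.03415 Ex. 8.2.5).

## Registered stubs (sorried; a prover closes one with `propose --supports stmt-HodgeConjecture-24864` BY NAME + SIGNATURE)
* `stub_firstOrderLift_pad4` (R; v1/v2/v3 text) — the UNIFORM rung: every datum with an f.l.f. κ-design upgrades to a first-order
  liftable one.  Size XL.  Implies R_at (`firstOrderLift_pad4_at_of_uniform`).
* `stub_firstOrderLift_pad4_at` (R_at; v2/v3 text) — **THE RUNG DESIGNATE and the ONLY load-bearing stub**.  Size XL.  WHY IT MIGHT
  FAIL: the 16 linear conditions `θ(ξ)·At(E₀) = 0` may be unsatisfiable by any f.l.f. design with Weil-bearing `ch₄` on `E₀⁸` (an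
  Atiyah-class obstruction theorem for Weil classes would refute X2‴ for the genuine `ch` — KILL CRITERIA of the route).
  Sources: Markman2025SurveySecant Q 11.4, Lemma 11.3, §12; BuchweitzFlenner2003 §4; FantechiManetti1999T1Lifting; arXiv:2502.03415
  Ex. 8.2.3–8.2.5; kit j292340.

## Disproof / negatives used
No `Disproof.lean` exists for X2′/X2″/X2‴.  `ledger negatives --problem HodgeConjecture`: none concerns semiregularity, first-order
lifting, Weil type or Serre's theorems.  Dead sub-lines honoured as in v2/v3.

## References
[cite: Hartshorne1977, II Thm. 5.17 p. 153, II Cor. 5.18, II Ex. 5.1] [cite: Fulton1998, Ex. 3.2.3, §15.1, Ex. 15.2.16 (b) p. 283]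
[cite: MumfordAV1970, §1 (3)] [cite: Markman2025SurveySecant, Q 11.4, Lemma 11.3, §11.4–§12] [cite: Markman2025SecantWeil, §1.5, §9]
[cite: BuchweitzFlenner2003, §4–§5] [cite: FantechiManetti1999T1Lifting, Thm. A] [cite: BlochEsnaultKerz2014CharZero, Thm. 2, Q 5]
[cite: vanGeemen1994HodgeAV, 4.3, 5.2–5.4] [cite: Schoen1988HodgeWeil] [cite: arXiv:2502.03415, Ex. 8.2.3–8.2.5]
[cite: HuybrechtsLehn1997, 2.A and Thm. 4.5.3] [cite: Mukai1978Semihomogeneous, §5–§6]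
-/

noncomputable section

-- single-problem summit (Problem = Summit): the mandated namespace repeats `HodgeConjecture`.
set_option linter.dupNamespace false

open CategoryTheory AlgebraicGeometry
open Literature.AlgebraicGeometry Literature.AlgebraicGeometry.Motives Literature.AlgebraicGeometry.HodgeTheory
open Literature.AlgebraicGeometry.Modules
open Literature.AlgebraicTopology.SingularHomology
open Summit.Ventures.HSemireg

namespace Summit.HodgeConjecture.HodgeConjecture.Cruxes.FirstOrderWeilSeedsEightCS.Birth

universe u

/-! ## §0 The object classes: `𝒪_C` named, and its class half -/

/-- **`𝒪_C` NAMED** — VERBATIM the object class inlined in the route decls `FirstOrderSemiregularTransfer` /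
`FirstOrderWeilSeedsEightCS` (finite locally free `E₀` on an abelian fibre, all Chern-character degrees `I = {0,…,n}`,
lifting to first order over every square-zero Artinian point of the base along every smooth projective family through `X₀`
on which `ch(E₀)` stays of Hodge type).  `firstOrderWeilSeedsEightCS_iff` checks the copy by `Iff.rfl`.
[cite: Markman2025SurveySecant, Q 11.4 (first-order reading)] [cite: FantechiManetti1999T1Lifting, §1] -/
def foClass (C : ChernCharacterBetti) : ObjClass :=
  fun (n : ℕ) (X₀ : Literature.AlgebraicGeometry.Motives.SchemeOver ℂ) (I : Finset ℕ) (κ : (p : ℕ) → Literature.AlgebraicGeometry.HodgeTheory.complexBetti X₀ (2 * p)) => I = Finset.range (n + 1) ∧ (∃ P₀ : Literature.AlgebraicGeometry.Motives.AbelianVariety ℂ, Nonempty (X₀ ≅ P₀.X)) ∧ ∃ (E₀ : X₀.left.Modules) (_ : Literature.AlgebraicGeometry.Motives.IsFiniteLocallyFree E₀), (∀ p ∈ I, κ p = C.ch X₀ E₀ p) ∧ ∀ ⦃𝒳 S : Literature.AlgebraicGeometry.Motives.SchemeOver ℂ⦄ (π : 𝒳 ⟶ S), Literature.AlgebraicGeometry.Motives.IsSmoothProjectiveFamily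 π n → AlgebraicGeometry.Smooth S.hom → ∀ ⦃U : Set (Literature.AlgebraicGeometry.Motives.ComplexPoints S)⦄ (hU : Literature.AlgebraicGeometry.HodgeTheory.IsCohomologicallyLocallyTrivialOn π U) (s₀ : U) (e : X₀ ≅ Literature.AlgebraicGeometry.Motives.fiberOver π s₀.1), (∀ p ∈ Finset.range (n + 1), ∀ (t : U) (γ : Path.Homotopic.Quotient s₀ t), Literature.AlgebraicGeometry.HodgeTheory.IsOfHodgeType n (Literature.AlgebraicGeometry.Motives.fiberOver π t.1) (2 * p) p p (Literature.AlgebraicGeometry.HodgeTheory.transportFun π (2 * p) hU γ (Literature.AlgebraicGeometry.HodgeTheory.complexBetti.map e.inv (2 * p) (C.ch X₀ E₀ p)))) → ∀ (A B : Type) [CommRing A] [Algebra ℂ A] [IsArtinianRing A] [IsLocalRing A] [CommRing B] [Algebra ℂ B] (f : A →ₐ[ℂ] B), Function.Surjective f → IsLocalRing.maximalIdeal A * IsLocalRing.maximalIdeal A = ⊥ → ∀ (ρ : B →ₐ[ℂ] ℂ) (a : Literature.AlgebraicGeometry.Motives.specOver ℂ A ⟶ S), CategoryTheory.CategoryStruct.comp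 (AlgebraicGeometry.Spec.map (CommRingCat.ofHom (ρ.comp f).toRingHom)) a.left = s₀.1.left → ∀ ⦃XA XB : AlgebraicGeometry.Scheme⦄ (gA : XA ⟶ 𝒳.left) (qA : XA ⟶ AlgebraicGeometry.Spec (CommRingCat.of A)), CategoryTheory.IsPullback gA qA π.left a.left → ∀ (i : XB ⟶ XA) (qB : XB ⟶ AlgebraicGeometry.Spec (CommRingCat.of B)), CategoryTheory.IsPullback i qB qA (AlgebraicGeometry.Spec.map (CommRingCat.ofHom f.toRingHom)) → ∀ (j : X₀.left ⟶ XB), CategoryTheory.IsPullback j X₀.hom qB (AlgebraicGeometry.Spec.map (CommRingCat.ofHom ρ.toRingHom)) → CategoryTheory.CategoryStruct.comp j (CategoryTheory.CategoryStruct.comp i gA) = CategoryTheory.CategoryStruct.comp e.hom.left (Literature.AlgebraicGeometry.Motives.fiberι π s₀.1).left → ∀ (F : XB.Modules), Literature.AlgebraicGeometry.Motives.IsVectorBundle F → Nonempty ((AlgebraicGeometry.Scheme.Modules.pullback j).obj F ≅ E₀) → Literature.AlgebraicGeometry.Deformation.LiftsAlong i F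

/-- **The CLASS HALF of `𝒪_C`** — the same with the first-order clause DELETED: finite locally free κ-designs on abelian
fibres (`κ_p = ch_p(E₀)` for `p ∈ I = {0,…,n}`).  Sub-rung vocabulary; NOT admissible for any transfer theorem by itself.
[cite: BuchweitzFlenner2003, §5 (sheaf data shape)] -/
def lfDesignClass (C : ChernCharacterBetti) : ObjClass :=
  fun (n : ℕ) (X₀ : Literature.AlgebraicGeometry.Motives.SchemeOver ℂ) (I : Finset ℕ) (κ : (p : ℕ) → Literature.AlgebraicGeometry.HodgeTheory.complexBetti X₀ (2 * p)) => I = Finset.range (n + 1) ∧ (∃ P₀ : Literature.AlgebraicGeometry.Motives.AbelianVariety ℂ, Nonempty (X₀ ≅ P₀.X)) ∧ ∃ (E₀ : X₀.left.Modules) (_ : Literature.AlgebraicGeometry.Motives.IsFiniteLocallyFree E₀), (∀ p ∈ I, κ p = C.ch X₀ E₀ p)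

/-- The route crux X2‴ IS `Serre → ∀ C d, 0 < d → HasHyperbolicSeedOn (foClass C) 4 d` — definitionally (the lambda was
copied verbatim from the rev-7 route decl `FirstOrderSemiregularSeeds.FirstOrderWeilSeedsEightCS`). -/
theorem firstOrderWeilSeedsEightCS_iff :
    Summit.HodgeConjecture.HodgeConjecture.Theses.FirstOrderSemiregularSeeds.FirstOrderWeilSeedsEightCS ↔
      (Hartshorne1977_serre_subbundleOfTwists →
        ∀ C : ChernCharacterBetti, ∀ d : ℕ, 0 < d → HasHyperbolicSeedOn (foClass C) 4 d) :=
  Iff.rfl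

/-- An `𝒪_C`-admissible `κ` is an f.l.f. κ-design (drop the first-order clause). -/
theorem lfDesignClass_of_foClass (C : ChernCharacterBetti) :
    ∀ n X₀ I κ, foClass C n X₀ I κ → lfDesignClass C n X₀ I κ := by
  rintro n X₀ I κ ⟨hI, hP, E₀, hE₀, hch, -⟩
  exact ⟨hI, hP, E₀, hE₀, hch⟩

/-! ## §1 The named anchor `S_d⁴`, `S_d = E₀ × E₀`, `φ = ψ₀ × (−ψ₀)`, `ψ₀ ≫ ψ₀ = -d` -/

section Anchor

variable (E₀ : AbelianVariety ℂ) (ψ₀ : E₀ ⟶ E₀)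

/-- The Weil surface `S = E₀ × E₀`. -/
abbrev weilSurf : AbelianVariety ℂ := E₀.prod E₀

/-- Its Weil action `φ_S = ψ₀ × (−ψ₀)` (the tree's `exists_weilType_cmSquare` shape). -/
abbrev weilSurfAct : weilSurf E₀ ⟶ weilSurf E₀ :=
  AbelianVariety.prodLift (AbelianVariety.fst E₀ E₀ ≫ ψ₀) (AbelianVariety.snd E₀ E₀ ≫ (-ψ₀))

/-- `S² = S × S`. -/
abbrev pad2Anchor : AbelianVariety ℂ := (weilSurf E₀).prod (weilSurf E₀)
/-- `S³ = S² × S`. -/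
abbrev pad3Anchor : AbelianVariety ℂ := (pad2Anchor E₀).prod (weilSurf E₀)
/-- **The PAD-4 anchor** `S⁴ = S³ × S` (as a complex torus `≅ E₀⁸`; Weil structure `(√-d, −√-d)⁴`, signature `(4,4)`). -/
abbrev pad4Anchor : AbelianVariety ℂ := (pad3Anchor E₀).prod (weilSurf E₀)

/-- Product action on `S²`. -/
abbrev pad2Action : pad2Anchor E₀ ⟶ pad2Anchor E₀ :=
  AbelianVariety.prodLift (AbelianVariety.fst _ _ ≫ weilSurfAct E₀ ψ₀) (AbelianVariety.snd _ _ ≫ weilSurfAct E₀ ψ₀)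
/-- Product action on `S³`. -/
abbrev pad3Action : pad3Anchor E₀ ⟶ pad3Anchor E₀ :=
  AbelianVariety.prodLift (AbelianVariety.fst _ _ ≫ pad2Action E₀ ψ₀) (AbelianVariety.snd _ _ ≫ weilSurfAct E₀ ψ₀)
/-- **The PAD-4 action** `ψ = φ_S × φ_S × φ_S × φ_S` on `S⁴`. -/
abbrev pad4Action : pad4Anchor E₀ ⟶ pad4Anchor E₀ :=
  AbelianVariety.prodLift (AbelianVariety.fst _ _ ≫ pad3Action E₀ ψ₀) (AbelianVariety.snd _ _ ≫ weilSurfAct E₀ ψ₀)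

/-- The `K`-symmetrised hyperplane class `h_K(d, e, a) = d·ι^*a + ψ^*ι^*a` (the literal shape inside `HasHyperbolicSeedOn 𝒪 4 d`). -/
abbrev symH (d : ℕ) {P : AbelianVariety ℂ} (ψ : P ⟶ P) (e : ProjectiveEmbedding P.X)
    (a : complexBetti (projectiveSpace e.n ℂ) 2) : complexBetti P.X 2 :=
  (d : ℂ) • complexBetti.map e.ι 2 a + complexBetti.map ψ.hom.hom.hom 2 (complexBetti.map e.ι 2 a)

variable {E₀ ψ₀}

/-- `dim S = 2·1`. -/
theorem weilSurf_dim (hE : E₀.dim = 1) : (weilSurf E₀).dim = 2 * 1 := by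
  show (E₀.prod E₀).dim = 2 * 1
  rw [AbelianVariety.dim_prod, hE]

/-- `dim S⁴ = 2·4`. -/
theorem pad4Anchor_dim (hE : E₀.dim = 1) : (pad4Anchor E₀).dim = 2 * 4 := by
  have h1 := weilSurf_dim hE
  have h2 : (pad2Anchor E₀).dim = 2 * (1 + 1) := dim_prod_eq_two_mul h1 h1
  have h3 : (pad3Anchor E₀).dim = 2 * ((1 + 1) + 1) := dim_prod_eq_two_mul h2 h1
  have h4 : (pad4Anchor E₀).dim = 2 * (((1 + 1) + 1) + 1) := dim_prod_eq_two_mul h3 h1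
  simpa using h4

/-- `(−ψ₀)² = ψ₀²`. -/
theorem neg_comp_neg_eq {d : ℕ} (hψ : ψ₀ ≫ ψ₀ = -(d • 𝟙 E₀)) : (-ψ₀) ≫ (-ψ₀) = -(d • 𝟙 E₀) := by
  rw [Preadditive.neg_comp_neg]; exact hψ

/-- `φ_S ≫ φ_S = -d`. -/
theorem weilSurfAct_comp_self {d : ℕ} (hψ : ψ₀ ≫ ψ₀ = -(d • 𝟙 E₀)) :
    weilSurfAct E₀ ψ₀ ≫ weilSurfAct E₀ ψ₀ = -(d • 𝟙 (weilSurf E₀)) :=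
  prodLift_comp_self_eq_neg_nsmul hψ (neg_comp_neg_eq hψ)

/-- **`ψ ≫ ψ = -d` on `S⁴`.** -/
theorem pad4Action_comp_self {d : ℕ} (hψ : ψ₀ ≫ ψ₀ = -(d • 𝟙 E₀)) :
    pad4Action E₀ ψ₀ ≫ pad4Action E₀ ψ₀ = -(d • 𝟙 (pad4Anchor E₀)) := by
  have hS := weilSurfAct_comp_self hψ
  have h2 : pad2Action E₀ ψ₀ ≫ pad2Action E₀ ψ₀ = -(d • 𝟙 (pad2Anchor E₀)) :=
    prodLift_comp_self_eq_neg_nsmul hS hS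
  have h3 : pad3Action E₀ ψ₀ ≫ pad3Action E₀ ψ₀ = -(d • 𝟙 (pad3Anchor E₀)) :=
    prodLift_comp_self_eq_neg_nsmul h2 hS
  exact prodLift_comp_self_eq_neg_nsmul h3 hS

/-- `dim S² = 2·2` (v2). -/
theorem pad2Anchor_dim (hE : E₀.dim = 1) : (pad2Anchor E₀).dim = 2 * 2 :=
  dim_prod_eq_two_mul (weilSurf_dim hE) (weilSurf_dim hE)

/-- `dim S³ = 2·3` (v2). -/
theorem pad3Anchor_dim (hE : E₀.dim = 1) : (pad3Anchor E₀).dim = 2 * 3 :=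
  dim_prod_eq_two_mul (pad2Anchor_dim hE) (weilSurf_dim hE)

/-- `φ ≫ φ = -d` on `S²` (v2). -/
theorem pad2Action_comp_self {d : ℕ} (hψ : ψ₀ ≫ ψ₀ = -(d • 𝟙 E₀)) :
    pad2Action E₀ ψ₀ ≫ pad2Action E₀ ψ₀ = -(d • 𝟙 (pad2Anchor E₀)) :=
  prodLift_comp_self_eq_neg_nsmul (weilSurfAct_comp_self hψ) (weilSurfAct_comp_self hψ)

/-- `φ ≫ φ = -d` on `S³` (v2). -/
theorem pad3Action_comp_self {d : ℕ} (hψ : ψ₀ ≫ ψ₀ = -(d • 𝟙 E₀)) :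
    pad3Action E₀ ψ₀ ≫ pad3Action E₀ ψ₀ = -(d • 𝟙 (pad3Anchor E₀)) :=
  prodLift_comp_self_eq_neg_nsmul (pad2Action_comp_self hψ) (weilSurfAct_comp_self hψ)

end Anchor

/-! ## §2 The CLASS HALF — IN THE TREE modulo the displayed Serre fact (hodge-fos-kappa-p1 p597041); one-line citations -/

/-- **The CLASS HALF `K` (datum + f.l.f. κ-design on the pinned anchor, for every `C`, `d`, CM datum), MODULO SERRE** —
`Theorems.kappaDesign_pad4_of_serre` with `𝒪 := lfDesignClass C`, `Ψ := pad4Action E₀ ψ₀`, `rfl`. [cite: Hartshorne1977, II Thm. 5.17] -/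
theorem kappaDesign_pad4_of_serre' (hS : Hartshorne1977_serre_subbundleOfTwists) :
    ∀ (C : ChernCharacterBetti) (d : ℕ), 0 < d →
      ∀ (E₀ : AbelianVariety ℂ) (ψ₀ : E₀ ⟶ E₀), E₀.dim = 1 → ψ₀ ≫ ψ₀ = -(d • 𝟙 E₀) →
      ∃ (e : ProjectiveEmbedding (pad4Anchor E₀).X) (a : complexBetti (projectiveSpace e.n ℂ) 2)
      (w : complexBetti (pad4Anchor E₀).X (2 * 4)),
      IsRationalClass a ∧ a ≠ 0 ∧
      IsHyperbolicWeilType (pad4Anchor E₀) (pad4Action E₀ ψ₀) 4 (symH d (pad4Action E₀ ψ₀) e a) ∧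
      w ∈ weilClassesOf (pad4Anchor E₀) (pad4Action E₀ ψ₀) 4 d ∧ IsRationalClass w ∧ w ≠ 0 ∧
      HasSeedOn (lfDesignClass C) 4 (pad4Anchor E₀) (symH d (pad4Action E₀ ψ₀) e a) w :=
  fun C _d hd E₀ ψ₀ hE hψ =>
    Summit.HodgeConjecture.HodgeConjecture.Theorems.kappaDesign_pad4_of_serre hS C (lfDesignClass C)
      (fun _ _ _ h₁ h₂ h₃ => ⟨h₁, h₂, h₃⟩) hd hE hψ (pad4Action E₀ ψ₀) rfl

/-- **The DESIGN-ONLY form `D` (every datum whose `w` is a rational `(4,4)` Weil class gets an f.l.f. κ-design for some `N·w`),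
MODULO SERRE** — `Theorems.lfDesign_pad4_of_serre`, same instantiation (the v2/v3 stub `stub_lfDesign_pad4`, now closed modulo
the displayed fact; no longer registered). -/
theorem lfDesign_pad4_of_serre' (hS : Hartshorne1977_serre_subbundleOfTwists) :
    ∀ (C : ChernCharacterBetti) (d : ℕ), 0 < d →
      ∀ (E₀ : AbelianVariety ℂ) (ψ₀ : E₀ ⟶ E₀), E₀.dim = 1 → ψ₀ ≫ ψ₀ = -(d • 𝟙 E₀) →
      ∀ (e : ProjectiveEmbedding (pad4Anchor E₀).X) (a : complexBetti (projectiveSpace e.n ℂ) 2)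
      (w : complexBetti (pad4Anchor E₀).X (2 * 4)),
      IsRationalClass a → a ≠ 0 →
      IsHyperbolicWeilType (pad4Anchor E₀) (pad4Action E₀ ψ₀) 4 (symH d (pad4Action E₀ ψ₀) e a) →
      w ∈ weilClassesOf (pad4Anchor E₀) (pad4Action E₀ ψ₀) 4 d → IsRationalClass w →
      IsOfHodgeType (2 * 4) (pad4Anchor E₀).X (2 * 4) 4 4 w → w ≠ 0 →
      ∃ w' : complexBetti (pad4Anchor E₀).X (2 * 4),
        w' ∈ weilClassesOf (pad4Anchor E₀) (pad4Action E₀ ψ₀) 4 d ∧ IsRationalClass w' ∧ w' ≠ 0 ∧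
        HasSeedOn (lfDesignClass C) 4 (pad4Anchor E₀) (symH d (pad4Action E₀ ψ₀) e a) w' :=
  fun C _d hd E₀ ψ₀ hE hψ e a w ha ha0 _ hwW hwQ hwH hw0 =>
    Summit.HodgeConjecture.HodgeConjecture.Theorems.lfDesign_pad4_of_serre hS C (lfDesignClass C)
      (fun _ _ _ h₁ h₂ h₃ => ⟨h₁, h₂, h₃⟩) hd hE hψ (pad4Action E₀ ψ₀) rfl e a w ha ha0 hwW hwQ hwH hw0

/-! ## §3 Registered stubs (theorem texts byte-for-byte the v2/v3 ones) -/

/-- **STUB R (v1/v2/v3 text; v4: the UNIFORM rung, implies the load-bearing `stub_firstOrderLift_pad4_at`) — THE RUNG (BC5 / T3 PLAN-ONLY) and THE BET: on the named anchor the class half UPGRADES to a FIRST-ORDER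
LIFTABLE f.l.f. κ-design** (`HasSeedOn (foClass C) 4 (S_d⁴) h_K w` from `HasSeedOn (lfDesignClass C) 4 (S_d⁴) h_K w`).
Technique: the Atiyah-class row test `θ(ξ) = ξ ∪ At(E₀) = 0 ∈ Ext²(E₀,E₀)` on the 16 Weil rows `T_W` (= the first-order
Hodge locus of `(h_K, w)` among polarised deformations at this anchor), certified per design by the instrument engine
(kit j292340 dictionary), then `LiftsAlong` over square-zero Artinian points (obstruction linear in the ideal).  Why it might
fail: module docstring.  J's designate `stub_firstOrderLift_EndSecant4` re-aimed (End-secant at Jacobian points: outcome (a)).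
[cite: Markman2025SurveySecant, Q 11.4 and Lemma 11.3] [cite: BuchweitzFlenner2003, §4] [cite: FantechiManetti1999T1Lifting, Thm. A] -/
theorem stub_firstOrderLift_pad4 :
    ∀ (C : ChernCharacterBetti) (d : ℕ), 0 < d →
      ∀ (E₀ : AbelianVariety ℂ) (ψ₀ : E₀ ⟶ E₀), E₀.dim = 1 → ψ₀ ≫ ψ₀ = -(d • 𝟙 E₀) →
      ∀ (e : ProjectiveEmbedding (pad4Anchor E₀).X) (a : complexBetti (projectiveSpace e.n ℂ) 2)
      (w : complexBetti (pad4Anchor E₀).X (2 * 4)),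
      IsRationalClass a → a ≠ 0 →
      IsHyperbolicWeilType (pad4Anchor E₀) (pad4Action E₀ ψ₀) 4 (symH d (pad4Action E₀ ψ₀) e a) →
      w ∈ weilClassesOf (pad4Anchor E₀) (pad4Action E₀ ψ₀) 4 d → IsRationalClass w → w ≠ 0 →
      HasSeedOn (lfDesignClass C) 4 (pad4Anchor E₀) (symH d (pad4Action E₀ ψ₀) e a) w →
      HasSeedOn (foClass C) 4 (pad4Anchor E₀) (symH d (pad4Action E₀ ψ₀) e a) w := by
  sorry

/-- **STUB R_at (v2/v3 text, J r2 F3; v4: THE ONLY LOAD-BEARING STUB of X2‴) — THE RUNG DESIGNATE, PINNED/EXISTENTIAL FORM**: on the named anchor, if SOME hyperbolic datum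
`(e, a, w)` carries a finite locally free κ-design (the class half's conclusion, verbatim) then SOME such datum carries a
FIRST-ORDER LIFTABLE one (the crux pinned to `S_d⁴(E₀)`).  Weaker than the uniform
`stub_firstOrderLift_pad4` (`firstOrderLift_pad4_at_of_uniform`), still strictly stronger than the crux at this anchor; decided
for a concrete design by the instrument's 16-row table, and by §Reductions the design must have an indecomposable summand with
non-scalar Atiyah class that is not a box product.  Technique and why it might fail: as for `stub_firstOrderLift_pad4`.
[cite: Markman2025SurveySecant, Q 11.4 and Lemma 11.3] [cite: BuchweitzFlenner2003, §4] [cite: FantechiManetti1999T1Lifting, Thm. A] -/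
theorem stub_firstOrderLift_pad4_at :
    ∀ (C : ChernCharacterBetti) (d : ℕ), 0 < d →
      ∀ (E₀ : AbelianVariety ℂ) (ψ₀ : E₀ ⟶ E₀), E₀.dim = 1 → ψ₀ ≫ ψ₀ = -(d • 𝟙 E₀) →
      (∃ (e : ProjectiveEmbedding (pad4Anchor E₀).X) (a : complexBetti (projectiveSpace e.n ℂ) 2)
        (w : complexBetti (pad4Anchor E₀).X (2 * 4)),
        IsRationalClass a ∧ a ≠ 0 ∧
        IsHyperbolicWeilType (pad4Anchor E₀) (pad4Action E₀ ψ₀) 4 (symH d (pad4Action E₀ ψ₀) e a) ∧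
        w ∈ weilClassesOf (pad4Anchor E₀) (pad4Action E₀ ψ₀) 4 d ∧ IsRationalClass w ∧ w ≠ 0 ∧
        HasSeedOn (lfDesignClass C) 4 (pad4Anchor E₀) (symH d (pad4Action E₀ ψ₀) e a) w) →
      (∃ (e : ProjectiveEmbedding (pad4Anchor E₀).X) (a : complexBetti (projectiveSpace e.n ℂ) 2)
        (w : complexBetti (pad4Anchor E₀).X (2 * 4)),
        IsRationalClass a ∧ a ≠ 0 ∧
        IsHyperbolicWeilType (pad4Anchor E₀) (pad4Action E₀ ψ₀) 4 (symH d (pad4Action E₀ ψ₀) e a) ∧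
        w ∈ weilClassesOf (pad4Anchor E₀) (pad4Action E₀ ψ₀) 4 d ∧ IsRationalClass w ∧ w ≠ 0 ∧
        HasSeedOn (foClass C) 4 (pad4Anchor E₀) (symH d (pad4Action E₀ ψ₀) e a) w) := by
  sorry

/-! ## §4 The composition (no sorry below) -/

/-- **the uniform rung implies the pinned one** (v2 text; so `Serre ∧ R ⟹ X2‴` as `Serre ∧ R ⟹ K ∧ R_at ⟹ X2‴`). [folklore] -/
theorem firstOrderLift_pad4_at_of_uniform
    (hR : ∀ (C : ChernCharacterBetti) (d : ℕ), 0 < d →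
      ∀ (E₀ : AbelianVariety ℂ) (ψ₀ : E₀ ⟶ E₀), E₀.dim = 1 → ψ₀ ≫ ψ₀ = -(d • 𝟙 E₀) →
      ∀ (e : ProjectiveEmbedding (pad4Anchor E₀).X) (a : complexBetti (projectiveSpace e.n ℂ) 2)
      (w : complexBetti (pad4Anchor E₀).X (2 * 4)),
      IsRationalClass a → a ≠ 0 →
      IsHyperbolicWeilType (pad4Anchor E₀) (pad4Action E₀ ψ₀) 4 (symH d (pad4Action E₀ ψ₀) e a) →
      w ∈ weilClassesOf (pad4Anchor E₀) (pad4Action E₀ ψ₀) 4 d → IsRationalClass w → w ≠ 0 →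
      HasSeedOn (lfDesignClass C) 4 (pad4Anchor E₀) (symH d (pad4Action E₀ ψ₀) e a) w →
      HasSeedOn (foClass C) 4 (pad4Anchor E₀) (symH d (pad4Action E₀ ψ₀) e a) w) :
    ∀ (C : ChernCharacterBetti) (d : ℕ), 0 < d →
      ∀ (E₀ : AbelianVariety ℂ) (ψ₀ : E₀ ⟶ E₀), E₀.dim = 1 → ψ₀ ≫ ψ₀ = -(d • 𝟙 E₀) →
      (∃ (e : ProjectiveEmbedding (pad4Anchor E₀).X) (a : complexBetti (projectiveSpace e.n ℂ) 2)
        (w : complexBetti (pad4Anchor E₀).X (2 * 4)),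
        IsRationalClass a ∧ a ≠ 0 ∧
        IsHyperbolicWeilType (pad4Anchor E₀) (pad4Action E₀ ψ₀) 4 (symH d (pad4Action E₀ ψ₀) e a) ∧
        w ∈ weilClassesOf (pad4Anchor E₀) (pad4Action E₀ ψ₀) 4 d ∧ IsRationalClass w ∧ w ≠ 0 ∧
        HasSeedOn (lfDesignClass C) 4 (pad4Anchor E₀) (symH d (pad4Action E₀ ψ₀) e a) w) →
      (∃ (e : ProjectiveEmbedding (pad4Anchor E₀).X) (a : complexBetti (projectiveSpace e.n ℂ) 2)
        (w : complexBetti (pad4Anchor E₀).X (2 * 4)),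
        IsRationalClass a ∧ a ≠ 0 ∧
        IsHyperbolicWeilType (pad4Anchor E₀) (pad4Action E₀ ψ₀) 4 (symH d (pad4Action E₀ ψ₀) e a) ∧
        w ∈ weilClassesOf (pad4Anchor E₀) (pad4Action E₀ ψ₀) 4 d ∧ IsRationalClass w ∧ w ≠ 0 ∧
        HasSeedOn (foClass C) 4 (pad4Anchor E₀) (symH d (pad4Action E₀ ψ₀) e a) w) := by
  intro C d hd E₀ ψ₀ hE hψ h
  obtain ⟨e, a, w, ha, ha0, hhyp, hwW, hwr, hw0, hseed⟩ := h
  exact ⟨e, a, w, ha, ha0, hhyp, hwW, hwr, hw0, hR C d hd E₀ ψ₀ hE hψ e a w ha ha0 hhyp hwW hwr hw0 hseed⟩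

/-- **COMPOSITION, hypothesis-explicit form with the PINNED rung** (v2 text): a class half `hK` and `R_at` give
`∀ C d, 0 < d → HasHyperbolicSeedOn (foClass C) 4 d`; both binders consumed (the CM curve from `exists_cmCurve_sqrt_neg d`,
`dim = 8` and `ψ² = -d` from §1). -/
theorem hasHyperbolicSeedOn_foClass_of_at
    (hK : ∀ (C : ChernCharacterBetti) (d : ℕ), 0 < d →
      ∀ (E₀ : AbelianVariety ℂ) (ψ₀ : E₀ ⟶ E₀), E₀.dim = 1 → ψ₀ ≫ ψ₀ = -(d • 𝟙 E₀) →
      ∃ (e : ProjectiveEmbedding (pad4Anchor E₀).X) (a : complexBetti (projectiveSpace e.n ℂ) 2)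
      (w : complexBetti (pad4Anchor E₀).X (2 * 4)),
      IsRationalClass a ∧ a ≠ 0 ∧
      IsHyperbolicWeilType (pad4Anchor E₀) (pad4Action E₀ ψ₀) 4 (symH d (pad4Action E₀ ψ₀) e a) ∧
      w ∈ weilClassesOf (pad4Anchor E₀) (pad4Action E₀ ψ₀) 4 d ∧ IsRationalClass w ∧ w ≠ 0 ∧
      HasSeedOn (lfDesignClass C) 4 (pad4Anchor E₀) (symH d (pad4Action E₀ ψ₀) e a) w)
    (hRat : ∀ (C : ChernCharacterBetti) (d : ℕ), 0 < d →
      ∀ (E₀ : AbelianVariety ℂ) (ψ₀ : E₀ ⟶ E₀), E₀.dim = 1 → ψ₀ ≫ ψ₀ = -(d • 𝟙 E₀) →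
      (∃ (e : ProjectiveEmbedding (pad4Anchor E₀).X) (a : complexBetti (projectiveSpace e.n ℂ) 2)
        (w : complexBetti (pad4Anchor E₀).X (2 * 4)),
        IsRationalClass a ∧ a ≠ 0 ∧
        IsHyperbolicWeilType (pad4Anchor E₀) (pad4Action E₀ ψ₀) 4 (symH d (pad4Action E₀ ψ₀) e a) ∧
        w ∈ weilClassesOf (pad4Anchor E₀) (pad4Action E₀ ψ₀) 4 d ∧ IsRationalClass w ∧ w ≠ 0 ∧
        HasSeedOn (lfDesignClass C) 4 (pad4Anchor E₀) (symH d (pad4Action E₀ ψ₀) e a) w) →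
      (∃ (e : ProjectiveEmbedding (pad4Anchor E₀).X) (a : complexBetti (projectiveSpace e.n ℂ) 2)
        (w : complexBetti (pad4Anchor E₀).X (2 * 4)),
        IsRationalClass a ∧ a ≠ 0 ∧
        IsHyperbolicWeilType (pad4Anchor E₀) (pad4Action E₀ ψ₀) 4 (symH d (pad4Action E₀ ψ₀) e a) ∧
        w ∈ weilClassesOf (pad4Anchor E₀) (pad4Action E₀ ψ₀) 4 d ∧ IsRationalClass w ∧ w ≠ 0 ∧
        HasSeedOn (foClass C) 4 (pad4Anchor E₀) (symH d (pad4Action E₀ ψ₀) e a) w)) :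
    ∀ (C : ChernCharacterBetti) (d : ℕ), 0 < d → HasHyperbolicSeedOn (foClass C) 4 d := by
  intro C d hd
  obtain ⟨E₀, ψ₀, hE, hψ⟩ :=
    Literature.NumberTheory.EllipticCurves.CMEndomorphism.exists_cmCurve_sqrt_neg d hd
  obtain ⟨e, a, w, ha, ha0, hhyp, hwW, hwr, hw0, hseed⟩ := hRat C d hd E₀ ψ₀ hE hψ (hK C d hd E₀ ψ₀ hE hψ)
  exact ⟨pad4Anchor E₀, pad4Action E₀ ψ₀, e, a, w, pad4Anchor_dim hE, pad4Action_comp_self hψ, ha, ha0, hhyp,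
    hwW, hwr, hw0, hseed⟩

/-- **THE SKELETON THEOREM (v4): the crux X2‴, concluded BY NAME, from the displayed Serre fact (its own antecedent), the
class half IN THE TREE and the REGISTERED STUB `stub_firstOrderLift_pad4_at` (pinned rung)** — the only theorem of this file whose
conclusion is the crux constant; `closed = false` until the rung is proved (the uniform `stub_firstOrderLift_pad4` suffices in its
place, `firstOrderLift_pad4_at_of_uniform`). -/
theorem FirstOrderWeilSeedsEightCS_of : Summit.HodgeConjecture.HodgeConjecture.Theses.FirstOrderSemiregularSeeds.FirstOrderWeilSeedsEightCS :=
  firstOrderWeilSeedsEightCS_iff.mpr fun hS =>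
    hasHyperbolicSeedOn_foClass_of_at (kappaDesign_pad4_of_serre' hS) stub_firstOrderLift_pad4_at

#print axioms kappaDesign_pad4_of_serre'
#print axioms FirstOrderWeilSeedsEightCS_of

end Summit.HodgeConjecture.HodgeConjecture.Cruxes.FirstOrderWeilSeedsEightCS.Birth

end
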